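import Mathlib
import Literature.MathematicalPhysics.QuantumFieldTheory.Balaban1983to89.B5G183FreeRowSum
import Summits.QuantumFields.BalabanUV.T4Continuum.Support.SliceCovariantTower

/-!
# T⁴ programme, node NE3 (η-rate of the minimisers) — THE FLAT RUNG, part 1: Bałaban's `U = 1` propagators
# `G = Δ_1⁻¹` of [B5] (1.73) (pv15's `B5DeltaA169.DeltaA`) TRANSPORTED to the NE3 carrier `(ℤ/NL^k)^{d+1} × Fin (d+1)`,
# and (3.42) item 0 IN THE SKELETON'S KERNEL FORM — block row sums `≤ B₀·(L^j)²·e^{−δ₀·nbd}` with LEVEL-FREE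
# constants — PROVED for them from pv15's `B5G183FreeRowSum.norm_DeltaA_one_inv_mulVec_le_uniform`

Thirteenth generation of the NE3 prover lineage P1 of the cell `pub-balaban`, file 5.  The stability side of NE3's skeleton
(`SliceCovariantPrincipal.ne3Shape_torusCovE_of_printedStatements`, p198587) asks, per level `j`, for [B9] Theorem 3.1's
(3.42) to HOLD for the auxiliary propagators — in kernel form (`SliceTorusSkeleton.sliceKernel_bound_torus_of_kernelBounds`,
binder `hG`): `Σ_{z ∈ Δ(y₁)} |G_j(x,z)| ≤ B₀·(L^j)²·e^{−δ₀·nbd(Δ(x), y₁)}` with `B₀, δ₀` independent of `j` and of the volume.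
At the FLAT background `U = 1` the auxiliary propagator of level `j` is Bałaban's `G = Δ_a⁻¹` of [B5] (1.71)–(1.73) with
`η = L^{−j}` — typed by the pv15 lineage as `B5DeltaA169.DeltaA n M a` (`n = η⁻¹`, coarse torus `Π_μ ℤ/M_μ`), for which
pv15 PROVED (first entry of (1.110) in operator form, `a = 1`, constants functions of `d` and the splitting order only,
uniform in `n` and in the torus) `B5G183FreeRowSum.norm_DeltaA_one_inv_mulVec_le_uniform`.  THIS FILE transports that
theorem to the NE3 carrier:
 * §1 the level-`j` reindexing `eF j : TPt (d+1) (N·L^k) ≃ B5Prop11Plancherel.Tor (fine (side k L j) (fun _ => levM k N L j))`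
   (`ZMod.ringEquivCongr` per coordinate along `N·L^k = L^{min(j,k)}·(N·L^{k−j})`, value-preserving), and the BLOCK
   DICTIONARY `cube_eq_iff_exists_bpt`: `cube j z = y ↔ ∃ r, eF j z = bpt n M y r` (Bałaban's blocks `B^j(y)` of [B5] (1.6)
   ARE the NE3 cubes);
 * §2 the FLAT AUXILIARY PROPAGATOR on the NE3 carrier `gFlat j p q := (L^{min(j,k)})²·Re (DeltaA n M 1)⁻¹ (eF p) (eF q)` (the
   factor `η⁻²` converts [B5]'s `η`-lattice operator to the skeleton's unit-lattice normalisation `m_j = a/(L^j)^{d+2}`,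
   cf. `SliceCovariantSkeleton.aB_mul_wB_sq`);
 * §3 the distance dictionary `nbd ≤ (d+1)·torusSupNorm` (the skeleton's integer ℓ¹ block distance against pv15's ℓ∞ torus
   distance of integer representatives);
 * §4 **`gFlat_rowBound`**: for every level `j`, every `p` and every block `y₁`,
   `Σ_{z : cubeI j z = y₁} |gFlat j p z| ≤ flatB₀ d · (L^j)² · exp(−flatδ₀ d · nbd j (cubeI j p) y₁)` with
   `flatB₀ d = 2d·2^d·e^{1/(2(d+1))} + (d+1)·MD183(d+1,d)·periodConst(κ₁₈₃(d+1),d)` and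
   `flatδ₀ d = min(1/(2(d+1)), κ₁₈₃(d+1)/(d+1))/(d+1)` — LEVEL-FREE, VOLUME-FREE: the binder `hG` of the skeleton
   ((3.42) item 0 in kernel form) DISCHARGED for the flat family.  Mechanism: test `(DeltaA)⁻¹` against the sign pattern of
   the real part of the row on the block (sup norm `≤ 1`, supported in Bałaban's block), `Σ|Re G| = Re (G J) ≤ ‖G J‖`.
HONEST SCOPE.  (i) Item 0 of (3.42) only — item 1 (`∇G`, `G∇*`: the skeleton's `hGD`) is NOT in pv15's tree (their HONEST
SCOPE (i)) and stays a reading; (ii) `U = 1` only (the flat rung; the covariant statement is [B9] Thm 3.1/3.3, printed, by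
name in the skeleton); (iii) `gFlat` is the REAL PART of the transported inverse; that it IS the skeleton's `gLevE E … j` for
the flat data (`Rm = 1`, `Kc = cubeComb`, `E` = unit vector Laplacian, `N_j` = the remainder incl. `−η²∂P_j∂*` and the
line-vs-block averaging deviation of [B5] (1.8)) needs the realness of `DeltaA`'s entries and the stencil dictionary — the
successor's part 2; (iv) constants crude (pv15's), nothing printed is matched; (v) `a = 1` (pv15's convention).

Honest framing: finite-T⁴ ultraviolet bookkeeping about MINIMISERS (rung (B)+1 of the cell's ladder); no conditional of
the cell (`BetaPertH`, (B), (B^μ)) is used or hidden; nothing bears on infinite volume, a mass gap, or the Clay problem;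
**NE3 is NOT proved**.  ABSOLUTE RULE of the cell kept: nothing printed is used as a hypothesis — the only inputs are
kernel-proved tree modules (pv15's `B5G183FreeRowSum`, the lineage's torus series); every declaration is a [model]
definition or a kernel-checked [folklore] theorem.  No `sorry`, no axioms beyond Mathlib's.  PLACEMENT (human rule
2026-08-19): cell work under `Summits/QuantumFields/BalabanUV/`; imports pv15's `B5G183FreeRowSum` and
`Support.SliceCovariantTower` (p198095); moves nothing.  Records: `t4/T4-EST-U1b-OSC.md` v1.26 (RESULT 34),
`t4/T4-EST-NE3-P1.md` v2.25, GAPS G-ne3p1-40 of the cell `pub-balaban`.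
-/

noncomputable section

open Finset Real Matrix

namespace Summit.QuantumFields.BalabanUV.T4Continuum.SliceFlatPropagator

open Literature.MathematicalPhysics.QuantumFieldTheory.Balaban1983to89
open Literature.MathematicalPhysics.QuantumFieldTheory.Balaban1983to89.TreeLengthTorus (TPt)
open Literature.MathematicalPhysics.QuantumFieldTheory.Balaban1983to89.B12Decay510Torus
  (pabs pabs_eq_natAbs pabs_nonneg pabs_le_abs_of_cast_eq pl1 pl1_eq_sum)
open Literature.MathematicalPhysics.QuantumFieldTheory.Balaban1983to89.B5Prop11Plancherel (Tor fine)
open Literature.MathematicalPhysics.QuantumFieldTheory.Balaban1983to89.B5Block118 (bpt)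
open Literature.MathematicalPhysics.QuantumFieldTheory.Balaban1983to89.B6LowerBound2153Torus (toT)
open Literature.MathematicalPhysics.QuantumFieldTheory.Balaban1983to89.B5DeltaA169 (DeltaA)
open Literature.MathematicalPhysics.QuantumFieldTheory.Balaban1983to89.B4TorusKernel (periodConst)
open Literature.MathematicalPhysics.QuantumFieldTheory.Balaban1983to89.B4TorusKernel.MultiPeriod (torusSupNorm circAbs)
open Literature.MathematicalPhysics.QuantumFieldTheory.Balaban1983to89.B5G183CovDecay (MD183 MD183_nonneg)
open Literature.MathematicalPhysics.QuantumFieldTheory.Balaban1983to89.B5G183Strip (kappa183 kappa183_pos)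
open Literature.MathematicalPhysics.QuantumFieldTheory.Balaban1983to89.B5Kernel166Decay (periodConst_pos)
open Literature.MathematicalPhysics.QuantumFieldTheory.Balaban1983to89.B5G183KernelDecay (bpt_toT)
open Literature.MathematicalPhysics.QuantumFieldTheory.Balaban1983to89.B5G183FreeRowSum
  (norm_DeltaA_one_inv_mulVec_le_uniform)
open Summit.QuantumFields.BalabanUV.T4Continuum.SliceTorusBlocks
open Summit.QuantumFields.BalabanUV.T4Continuum.SliceTorusTower
open Summit.QuantumFields.BalabanUV.T4Continuum.SliceCovariantTower

/-! ## §1  The level-`j` reindexing of the NE3 torus as Bałaban's fine torus over the level-`j` blocks -/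
section Reindex

variable (d k N L : ℕ) [NeZero N] [NeZero L]

/-- The coarse multi-period of level `j`: `levM k N L j = N·L^{k−j}` blocks in every direction. [model] [folklore] -/
abbrev Mlev (j : ℕ) : Fin (d + 1) → ℕ := fun _ => levM k N L j

/-- The block side `L^{min(j,k)}` is non-zero. [folklore] -/
instance side_neZero (j : ℕ) : NeZero (side k L j) := ⟨by unfold side; exact pow_ne_zero _ (NeZero.ne L)⟩

/-- `1 ≤ L^{min(j,k)}`. [folklore] -/
theorem one_le_side (j : ℕ) : 1 ≤ side k L j := Nat.one_le_iff_ne_zero.2 (NeZero.ne _)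

omit [NeZero N] [NeZero L] in
/-- `N·L^k = L^{min(j,k)}·(N·L^{k−j})`: the fine torus is Bałaban's `T_η` over the level-`j` blocks. [folklore] -/
theorem fine_eq_side_mul_levM (j : ℕ) : N * L ^ k = side k L j * levM k N L j := by
  rw [mul_comm (side k L j)]; exact fine_eq_levM_mul_side k N L j

/-- The coordinate cast `ℤ/(N·L^k) ≃+* ℤ/(L^{min(j,k)}·N·L^{k−j})`. [folklore] -/
def castF (j : ℕ) : ZMod (N * L ^ k) ≃+* ZMod (side k L j * levM k N L j) :=
  ZMod.ringEquivCongr (fine_eq_side_mul_levM k N L j)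

/-- **The level-`j` reindexing** of the NE3 fine torus `(ℤ/NL^k)^{d+1}` as pv15's `Tor (fine n M)` with `n = L^{min(j,k)}`,
`M ≡ N·L^{k−j}`. [model] [folklore] -/
def eF (j : ℕ) : TPt (d + 1) (N * L ^ k) ≃ Tor (fine (side k L j) (Mlev d k N L j)) where
  toFun x μ := castF k N L j (x μ)
  invFun y μ := (castF k N L j).symm (y μ)
  left_inv _ := funext fun _ => RingEquiv.symm_apply_apply _ _
  right_inv _ := funext fun _ => RingEquiv.apply_symm_apply _ _

omit [NeZero N] [NeZero L] in
/-- The reindexing preserves the values of the coordinates. [folklore] -/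
theorem val_eF (j : ℕ) (x : TPt (d + 1) (N * L ^ k)) (μ : Fin (d + 1)) :
    ZMod.val (eF d k N L j x μ) = ZMod.val (x μ) :=
  ZMod.ringEquivCongr_val _ _

/-- A coarse point is the class of its values. [folklore] -/
theorem toT_val (j : ℕ) (y : TPt (d + 1) (levM k N L j)) :
    toT (Mlev d k N L j) (fun μ => ((y μ).val : ℤ)) = y := by
  funext μ
  show (((y μ).val : ℤ) : ZMod (levM k N L j)) = y μ
  rw [Int.cast_natCast, ZMod.natCast_zmod_val]

/-- The value of a block point coordinate: `val((n·ȳ + r)_μ) = n·val(y_μ) + r_μ`. [folklore] -/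
theorem val_bpt (j : ℕ) (y : TPt (d + 1) (levM k N L j)) (r : Fin (d + 1) → Fin (side k L j)) (μ : Fin (d + 1)) :
    ZMod.val (bpt (side k L j) (Mlev d k N L j) y r μ) = side k L j * (y μ).val + r μ := by
  have h := bpt_toT (side k L j) (Mlev d k N L j) (fun μ => ((y μ).val : ℤ)) r
  rw [toT_val] at h
  rw [h]
  show ZMod.val ((((side k L j : ℤ) * (y μ).val + ((r μ : ℕ) : ℤ) : ℤ) : ZMod (side k L j * levM k N L j))) = _
  have hlt : side k L j * (y μ).val + r μ < side k L j * levM k N L j := by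
    have hy : (y μ).val < levM k N L j := ZMod.val_lt _
    have hr : (r μ : ℕ) < side k L j := (r μ).isLt
    calc side k L j * (y μ).val + r μ < side k L j * (y μ).val + side k L j := by omega
      _ = side k L j * ((y μ).val + 1) := by ring
      _ ≤ side k L j * levM k N L j := Nat.mul_le_mul_left _ hy
  have hcast : (((side k L j : ℤ) * (y μ).val + ((r μ : ℕ) : ℤ) : ℤ) : ZMod (side k L j * levM k N L j))
      = ((side k L j * (y μ).val + r μ : ℕ) : ZMod (side k L j * levM k N L j)) := by
    push_cast; ring
  rw [hcast, ZMod.val_natCast, Nat.mod_eq_of_lt hlt]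

/-- **BLOCK DICTIONARY**: the site `z` lies in the level-`j` cube `y` (NE3's `cube j z = y`) iff its reindexing is one of
Bałaban's block points `n·ȳ + r`, `0 ≤ r_μ < n` ([B5] (1.6)). [folklore] -/
theorem cube_eq_iff_exists_bpt (j : ℕ) (z : TPt (d + 1) (N * L ^ k)) (y : TPt (d + 1) (levM k N L j)) :
    cube (d + 1) k N L j z = y ↔ ∃ r : Fin (d + 1) → Fin (side k L j), eF d k N L j z = bpt (side k L j) (Mlev d k N L j) y r := by
  have hside : 0 < side k L j := one_le_side k L j
  constructor
  · intro h
    refine ⟨fun μ => ⟨(z μ).val % side k L j, Nat.mod_lt _ hside⟩, funext fun μ => ?_⟩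
    apply ZMod.val_injective
    rw [val_eF, val_bpt]
    have hμ : ((z μ).val / side k L j : ℕ) = (y μ).val := by
      have := congrArg ZMod.val (congrFun h μ)
      rwa [show cube (d + 1) k N L j z μ = blockOf (levM k N L j) (side k L j) (z μ) from rfl,
        val_blockOf (fine_eq_levM_mul_side k N L j)] at this
    have := Nat.div_add_mod (z μ).val (side k L j)
    rw [hμ] at this
    simp only
    omega
  · rintro ⟨r, h⟩
    funext μ
    have hv : (z μ).val = side k L j * (y μ).val + r μ := by rw [← val_eF d k N L j z μ, h, val_bpt]
    show blockOf (levM k N L j) (side k L j) (z μ) = y μ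
    unfold SliceTorusBlocks.blockOf
    rw [hv]
    have hr : (r μ : ℕ) < side k L j := (r μ).isLt
    have : (side k L j * (y μ).val + r μ) / side k L j = (y μ).val := by
      rw [Nat.mul_add_div hside, Nat.div_eq_of_lt hr, add_zero]
    rw [this, ZMod.natCast_zmod_val]

end Reindex

/-! ## §2  The flat auxiliary propagators on the NE3 carrier -/
section Flat

variable (d k N L : ℕ) [NeZero N] [NeZero L]

/-- **THE FLAT LEVEL-`j` AUXILIARY PROPAGATOR ON THE NE3 CARRIER**: `(L^{min(j,k)})² ·` the real part of Bałaban's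
`G = Δ_1⁻¹` ([B5] (1.71)–(1.73), pv15's `(DeltaA n M 1)⁻¹`, `n = L^{min(j,k)}`, `M ≡ N·L^{k−j}`) transported along the
reindexing — the factor `η⁻² = n²` is the unit-lattice normalisation of the skeleton (mass coefficient `a/(L^j)^{d+2}`). [model] -/
def gFlat (j : ℕ) : Matrix (TPt (d + 1) (N * L ^ k) × Fin (d + 1)) (TPt (d + 1) (N * L ^ k) × Fin (d + 1)) ℝ :=
  fun p q => ((side k L j : ℝ) ^ 2) *
    ((DeltaA (side k L j) (Mlev d k N L j) 1)⁻¹ (eF d k N L j p.1, p.2) (eF d k N L j q.1, q.2)).re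

/-- The level-free constant of the flat rung (pv15's two constants at splitting order `d`, summed). [folklore] -/
def flatB₀ (d : ℕ) : ℝ :=
  2 * (d : ℝ) * 2 ^ d * Real.exp (1 / (2 * ((d : ℝ) + 1)))
    + ((d : ℝ) + 1) * (MD183 (d + 1) d * periodConst (kappa183 (d + 1)) d)

/-- The level-free decay rate of the flat rung (pv15's two rates, in the ℓ¹ block distance). [folklore] -/
def flatδ₀ (d : ℕ) : ℝ := min (1 / (2 * ((d : ℝ) + 1))) (kappa183 (d + 1) / ((d : ℝ) + 1)) / ((d : ℝ) + 1)

/-- `0 < flatδ₀`. [folklore] -/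
theorem flatδ₀_pos (d : ℕ) : 0 < flatδ₀ d := by
  unfold flatδ₀
  have h1 : (0 : ℝ) < 1 / (2 * (d + 1)) := by positivity
  have h2 : (0 : ℝ) < kappa183 (d + 1) / (d + 1) := div_pos (kappa183_pos _) (by positivity)
  exact div_pos (lt_min h1 h2) (by positivity)

/-- `0 ≤ flatB₀`. [folklore] -/
theorem flatB₀_nonneg (d : ℕ) : 0 ≤ flatB₀ d := by
  unfold flatB₀
  have h1 : 0 ≤ MD183 (d + 1) d := MD183_nonneg _ _
  have h2 : 0 ≤ periodConst (kappa183 (d + 1)) d := (periodConst_pos (kappa183_pos _) d).le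
  positivity

end Flat

/-! ## §3  The distance dictionary: NE3's integer ℓ¹ block distance against pv15's ℓ∞ torus distance -/
section Distance

variable {d k N L : ℕ} [NeZero N] [NeZero L]

/-- `pabs` of a class is at most the circular distance of any integer representative. [folklore] -/
theorem pabs_le_circAbs {T : ℕ} [NeZero T] (t : ℤ) : pabs ((t : ZMod T)) ≤ circAbs T t := by
  have hT : (0 : ℤ) < T := by exact_mod_cast Nat.pos_of_ne_zero (NeZero.ne T)
  have hmod : ((t % (T : ℤ) : ℤ) : ZMod T) = (t : ZMod T) := ZMod.intCast_mod t T
  have h0 : 0 ≤ t % (T : ℤ) := Int.emod_nonneg _ hT.ne'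
  have hlt : t % (T : ℤ) < T := Int.emod_lt_of_pos _ hT
  have h1 : pabs ((t : ZMod T)) ≤ t % (T : ℤ) := by
    have := pabs_le_abs_of_cast_eq hmod
    rwa [abs_of_nonneg h0] at this
  have h2 : pabs ((t : ZMod T)) ≤ (T : ℤ) - t % (T : ℤ) := by
    have hmod' : ((t % (T : ℤ) - T : ℤ) : ZMod T) = (t : ZMod T) := by
      rw [Int.cast_sub, hmod, Int.cast_natCast, ZMod.natCast_self, sub_zero]
    have := pabs_le_abs_of_cast_eq hmod'
    rwa [abs_of_nonpos (by linarith), neg_sub] at this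
  show pabs ((t : ZMod T)) ≤ min (t % (T : ℤ)) ((T : ℤ) - t % (T : ℤ))
  exact le_min h1 h2

/-- **`nbd ≤ (d+1)·torusSupNorm`**: the skeleton's ℓ¹ block distance of two level-`j` cubes is at most `d+1` times pv15's
ℓ∞ torus distance of their value representatives. [folklore] -/
theorem nbd_le_torusSupNorm (j : ℕ) (y y₁ : TPt (d + 1) (levM k N L j)) :
    (nbd (d + 1) k N L j y y₁ : ℝ)
      ≤ (d + 1) * torusSupNorm (Mlev d k N L j) (fun μ => ((y μ).val : ℤ) - ((y₁ μ).val : ℤ)) := by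
  have hcast : (nbd (d + 1) k N L j y y₁ : ℝ) = ∑ μ, (pabs ((y - y₁) μ) : ℝ) := by
    unfold nbd; rw [cast_npl1, pl1_eq_sum]
  rw [hcast]
  have hterm : ∀ μ, (pabs ((y - y₁) μ) : ℝ)
      ≤ torusSupNorm (Mlev d k N L j) (fun μ => ((y μ).val : ℤ) - ((y₁ μ).val : ℤ)) := by
    intro μ
    have hrep : ((((y μ).val : ℤ) - ((y₁ μ).val : ℤ) : ℤ) : ZMod (levM k N L j)) = (y - y₁) μ := by
      rw [Int.cast_sub, Int.cast_natCast, Int.cast_natCast, ZMod.natCast_zmod_val, ZMod.natCast_zmod_val]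
      rfl
    have h1 : (pabs ((y - y₁) μ) : ℝ) ≤ (circAbs (levM k N L j) (((y μ).val : ℤ) - ((y₁ μ).val : ℤ)) : ℝ) := by
      have := pabs_le_circAbs (T := levM k N L j) (((y μ).val : ℤ) - ((y₁ μ).val : ℤ))
      rw [hrep] at this
      exact_mod_cast this
    refine h1.trans ?_
    unfold torusSupNorm
    exact Finset.le_sup' (fun i => (circAbs (Mlev d k N L j i) ((((y i).val : ℤ) - ((y₁ i).val : ℤ))) : ℝ))
      (Finset.mem_univ μ)
  calc ∑ μ, (pabs ((y - y₁) μ) : ℝ)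
      ≤ ∑ _μ : Fin (d + 1), torusSupNorm (Mlev d k N L j) (fun μ => ((y μ).val : ℤ) - ((y₁ μ).val : ℤ)) :=
        Finset.sum_le_sum fun μ _ => hterm μ
    _ = (d + 1) * _ := by rw [Finset.sum_const, Finset.card_univ, Fintype.card_fin, nsmul_eq_mul]; push_cast; ring

end Distance

/-! ## §4  (3.42) item 0 in kernel form for the flat family, from pv15's n-uniform block row sums -/
section RowBound

variable (d k N L : ℕ) [NeZero N] [NeZero L]

/-- The sign test function of a row on a block: real signs of the real parts, as complex numbers. [folklore] -/
def signTest (j : ℕ) (p : TPt (d + 1) (N * L ^ k) × Fin (d + 1)) (y₁ : TPt (d + 1) (levM k N L j))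
    (q : Tor (fine (side k L j) (Mlev d k N L j)) × Fin (d + 1)) : ℂ :=
  if cube (d + 1) k N L j ((eF d k N L j).symm q.1) = y₁ then
    (if 0 ≤ ((DeltaA (side k L j) (Mlev d k N L j) 1)⁻¹ (eF d k N L j p.1, p.2) q).re then 1 else -1)
  else 0

/-- The sign test has sup norm `≤ 1`. [folklore] -/
theorem norm_signTest_le (j : ℕ) (p : TPt (d + 1) (N * L ^ k) × Fin (d + 1)) (y₁ : TPt (d + 1) (levM k N L j))
    (q : Tor (fine (side k L j) (Mlev d k N L j)) × Fin (d + 1)) : ‖signTest d k N L j p y₁ q‖ ≤ 1 := by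
  unfold signTest
  split_ifs <;> simp

/-- The sign test is supported in Bałaban's block of `y₁`. [folklore] -/
theorem signTest_supp (j : ℕ) (p : TPt (d + 1) (N * L ^ k) × Fin (d + 1)) (y₁ : TPt (d + 1) (levM k N L j))
    (q : Tor (fine (side k L j) (Mlev d k N L j)) × Fin (d + 1)) (hq : signTest d k N L j p y₁ q ≠ 0) :
    ∃ r' : Fin (d + 1) → Fin (side k L j),
      q.1 = bpt (side k L j) (Mlev d k N L j) (toT (Mlev d k N L j) (fun μ => ((y₁ μ).val : ℤ))) r' := by
  unfold signTest at hq
  by_cases h : cube (d + 1) k N L j ((eF d k N L j).symm q.1) = y₁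
  · obtain ⟨r, hr⟩ := (cube_eq_iff_exists_bpt d k N L j ((eF d k N L j).symm q.1) y₁).1 h
    refine ⟨r, ?_⟩
    rw [toT_val, ← hr, Equiv.apply_symm_apply]
  · exact absurd (by rw [if_neg h]) hq

/-- The real part of the tested row IS the block row sum of `|Re G|`. [folklore] -/
theorem re_mulVec_signTest (j : ℕ) (p : TPt (d + 1) (N * L ^ k) × Fin (d + 1)) (y₁ : TPt (d + 1) (levM k N L j)) :
    (((DeltaA (side k L j) (Mlev d k N L j) 1)⁻¹ *ᵥ signTest d k N L j p y₁) (eF d k N L j p.1, p.2)).re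
      = ∑ q, if cube (d + 1) k N L j ((eF d k N L j).symm q.1) = y₁ then
          |((DeltaA (side k L j) (Mlev d k N L j) 1)⁻¹ (eF d k N L j p.1, p.2) q).re| else 0 := by
  rw [Matrix.mulVec, dotProduct, Complex.re_sum]
  refine Finset.sum_congr rfl fun q _ => ?_
  unfold signTest
  split_ifs with h1 h2
  · rw [mul_one, abs_of_nonneg h2]
  · rw [mul_neg, mul_one, Complex.neg_re, abs_of_neg (lt_of_not_ge h2)]
  · rw [mul_zero, Complex.zero_re]

/-- The block row sum of `|gFlat|` on the NE3 carrier is `n²·` the tested real part. [folklore] -/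
theorem rowSum_gFlat_eq (j : ℕ) (p : TPt (d + 1) (N * L ^ k) × Fin (d + 1)) (y₁ : TPt (d + 1) (levM k N L j)) :
    ∑ z ∈ Finset.univ.filter (fun z => cubeI (d + 1) k N L (Fin (d + 1)) j z = y₁), |gFlat d k N L j p z|
      = ((side k L j : ℝ) ^ 2) *
        (((DeltaA (side k L j) (Mlev d k N L j) 1)⁻¹ *ᵥ signTest d k N L j p y₁) (eF d k N L j p.1, p.2)).re := by
  rw [re_mulVec_signTest, Finset.sum_filter, Finset.mul_sum]
  -- reindex the sum along `z ↦ (eF z.1, z.2)`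
  let Φ : TPt (d + 1) (N * L ^ k) × Fin (d + 1) ≃ Tor (fine (side k L j) (Mlev d k N L j)) × Fin (d + 1) :=
    Equiv.prodCongr (eF d k N L j) (Equiv.refl _)
  rw [← Equiv.sum_comp Φ]
  refine Finset.sum_congr rfl fun z _ => ?_
  have hz : (eF d k N L j).symm (Φ z).1 = z.1 := by
    show (eF d k N L j).symm (eF d k N L j z.1) = z.1
    exact Equiv.symm_apply_apply _ _
  simp only [cubeI_apply, hz]
  split_ifs with h
  · rw [gFlat, abs_mul, abs_of_nonneg (by positivity)]
    rfl
  · rw [mul_zero]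

/-- **(3.42) ITEM 0 IN KERNEL FORM FOR THE FLAT FAMILY — PROVED.**  For every level `j`, every site-with-component `p`
and every level-`j` block `y₁` of the NE3 torus `(ℤ/NL^k)^{d+1}`:
`Σ_{z : cubeI j z = y₁} |gFlat j p z| ≤ flatB₀ d · (L^j)² · exp(−flatδ₀ d · nbd j (cubeI j p) y₁)`, with `flatB₀ d`,
`flatδ₀ d > 0` depending on the dimension ONLY (uniform in `j`, `k`, `N`, `L`) — the binder `hG` of
`SliceTorusSkeleton.sliceKernel_bound_torus_of_kernelBounds` ∕ the `m = 0` clause of `ineq342_matrixFamily_of_rowBounds`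
for the flat auxiliary propagators, from pv15's `B5G183FreeRowSum.norm_DeltaA_one_inv_mulVec_le_uniform` (first entry of
[B5] (1.110) in operator form, `a = 1`, n-uniform) by the sign test and the two dictionaries. [folklore] -/
theorem gFlat_rowBound (j : ℕ) (p : TPt (d + 1) (N * L ^ k) × Fin (d + 1)) (y₁ : TPt (d + 1) (levM k N L j)) :
    ∑ z ∈ Finset.univ.filter (fun z => cubeI (d + 1) k N L (Fin (d + 1)) j z = y₁), |gFlat d k N L j p z|
      ≤ flatB₀ d * ((L : ℝ) ^ j) ^ 2
        * Real.exp (-(flatδ₀ d * nbd (d + 1) k N L j (cubeI (d + 1) k N L (Fin (d + 1)) j p) y₁)) := by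
  set n := side k L j
  set Mj := Mlev d k N L j
  have hn1 : 1 ≤ n := one_le_side k L j
  -- the row point as a Bałaban block point of its own cube
  set y : TPt (d + 1) (levM k N L j) := cube (d + 1) k N L j p.1
  obtain ⟨r, hr⟩ := (cube_eq_iff_exists_bpt d k N L j p.1 y).1 rfl
  set x : Fin (d + 1) → ℤ := fun μ => ((y μ).val : ℤ)
  set x' : Fin (d + 1) → ℤ := fun μ => ((y₁ μ).val : ℤ)
  have hyx : toT Mj x = y := toT_val d k N L j y
  -- pv15's n-uniform row bound, tested against the sign pattern of the block
  have hpv := norm_DeltaA_one_inv_mulVec_le_uniform n hn1 Mj (Nn := d) le_rfl x x'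
    (signTest d k N L j p y₁) (B := 1) (norm_signTest_le d k N L j p y₁) (signTest_supp d k N L j p y₁) r p.2
  rw [hyx, ← hr, one_mul] at hpv
  -- the block row sum is n²·Re(tested row) ≤ n²·‖tested row‖
  rw [rowSum_gFlat_eq]
  have hre := Complex.re_le_norm
    (((DeltaA n Mj 1)⁻¹ *ᵥ signTest d k N L j p y₁) (eF d k N L j p.1, p.2))
  have hn2 : (0 : ℝ) ≤ (n : ℝ) ^ 2 := by positivity
  have hnL : (n : ℝ) ^ 2 ≤ ((L : ℝ) ^ j) ^ 2 :=
    pow_le_pow_left₀ (Nat.cast_nonneg _) (side_le_pow k L j) 2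
  -- the distance dictionary
  have hT := nbd_le_torusSupNorm (d := d) (k := k) (N := N) (L := L) j y y₁
  set T := torusSupNorm Mj (x - x') with hTdef
  have hTx : torusSupNorm Mj (fun μ => ((y μ).val : ℤ) - ((y₁ μ).val : ℤ)) = T := by rw [hTdef]; rfl
  rw [hTx] at hT
  set D := (nbd (d + 1) k N L j y y₁ : ℝ) with hDdef
  have hd1 : (0 : ℝ) < d + 1 := by positivity
  have hTD : D / (d + 1) ≤ T := by rw [div_le_iff₀ hd1]; linarith
  have hD0 : 0 ≤ D := Nat.cast_nonneg _
  -- the two exponentials against the ℓ¹ rate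
  have hδle1 : flatδ₀ d * D ≤ 1 / (2 * (d + 1)) * T := by
    have h1 : flatδ₀ d ≤ 1 / (2 * (d + 1)) / (d + 1) :=
      div_le_div_of_nonneg_right (min_le_left _ _) hd1.le
    calc flatδ₀ d * D ≤ 1 / (2 * (d + 1)) / (d + 1) * D := mul_le_mul_of_nonneg_right h1 hD0
      _ = 1 / (2 * (d + 1)) * (D / (d + 1)) := by ring
      _ ≤ 1 / (2 * (d + 1)) * T := mul_le_mul_of_nonneg_left hTD (by positivity)
  have hδle2 : flatδ₀ d * D ≤ kappa183 (d + 1) / (d + 1) * T := by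
    have h1 : flatδ₀ d ≤ kappa183 (d + 1) / (d + 1) / (d + 1) :=
      div_le_div_of_nonneg_right (min_le_right _ _) hd1.le
    have hκ : 0 ≤ kappa183 (d + 1) / (d + 1) := (div_pos (kappa183_pos _) hd1).le
    calc flatδ₀ d * D ≤ kappa183 (d + 1) / (d + 1) / (d + 1) * D := mul_le_mul_of_nonneg_right h1 hD0
      _ = kappa183 (d + 1) / (d + 1) * (D / (d + 1)) := by ring
      _ ≤ kappa183 (d + 1) / (d + 1) * T := mul_le_mul_of_nonneg_left hTD hκ
  have he1 : Real.exp (-(1 / (2 * ((d : ℝ) + 1)) * T)) ≤ Real.exp (-(flatδ₀ d * D)) :=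
    Real.exp_le_exp.2 (by linarith)
  have he2 : Real.exp (-(kappa183 (d + 1) / ((d : ℝ) + 1) * T)) ≤ Real.exp (-(flatδ₀ d * D)) :=
    Real.exp_le_exp.2 (by linarith)
  have hC1 : (0 : ℝ) ≤ 2 * d * 2 ^ d * Real.exp (1 / (2 * (d + 1))) := by positivity
  have hC2 : (0 : ℝ) ≤ (d + 1) * (MD183 (d + 1) d * periodConst (kappa183 (d + 1)) d) :=
    mul_nonneg (by positivity) (mul_nonneg (MD183_nonneg _ _) (periodConst_pos (kappa183_pos _) d).le)
  have hbound : ‖((DeltaA n Mj 1)⁻¹ *ᵥ signTest d k N L j p y₁) (eF d k N L j p.1, p.2)‖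
      ≤ flatB₀ d * Real.exp (-(flatδ₀ d * D)) := by
    refine hpv.trans ?_
    unfold flatB₀
    have t1 := mul_le_mul_of_nonneg_left he1 hC1
    have t2 := mul_le_mul_of_nonneg_left he2 hC2
    nlinarith [t1, t2]
  have hR : 0 ≤ flatB₀ d * Real.exp (-(flatδ₀ d * D)) := mul_nonneg (flatB₀_nonneg d) (Real.exp_nonneg _)
  calc (n : ℝ) ^ 2 * (((DeltaA n Mj 1)⁻¹ *ᵥ signTest d k N L j p y₁) (eF d k N L j p.1, p.2)).re
      ≤ (n : ℝ) ^ 2 * (flatB₀ d * Real.exp (-(flatδ₀ d * D))) :=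
        mul_le_mul_of_nonneg_left (hre.trans hbound) hn2
    _ ≤ ((L : ℝ) ^ j) ^ 2 * (flatB₀ d * Real.exp (-(flatδ₀ d * D))) := mul_le_mul_of_nonneg_right hnL hR
    _ = flatB₀ d * ((L : ℝ) ^ j) ^ 2 * Real.exp (-(flatδ₀ d * D)) := by ring

end RowBound

end Summit.QuantumFields.BalabanUV.T4Continuum.SliceFlatPropagator
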